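import Summits.Ventures.YMGap.RobustBall.IsingBallB2
import Literature.Probability.LatticeModels.IsingDecoration
import Literature.Probability.LatticeModels.GKSInequalities
import Literature.Probability.LatticeModels.SharpnessProofs
import HarnessLib

/-!
# RobustBall/IsingBallB2Bound — the boundary two-point functions of `B₂` (heat-bath reduction), Griffiths monotonicity, and the rung-3 Simon–Lieb
# bounds `5·∑_axis ⟨σ_0σ_x⟩ + 4·∑_corner ⟨σ_0σ_x⟩ ≤ B` for `0 ≤ β ≤ artanh(4/21)` (`B = 5.13807…`) and for `0 ≤ β ≤ artanh(23/120)` (`B = 5.20999…`)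

HONEST FRAMING: venture file of the cell `pub-ymgap` (QuantumFields programme), track Y2 ROBUST-BALL / DS seat ds-4 (g10).  Finite statements about the
free-boundary, zero-field Ising model on the explicit 25-vertex graph `b2Graph` (`IsingBallB2`); nothing about `SU(2)`, the torus or the continuum here.

WHAT.  (i) HEAT-BATH REDUCTION of the 18 boundary sites (the tree's one-site DLR identity `isingExpect_spinAt_mul_eq_tanh`, van Enter–Fernández–Sokal
(4.6)): an axis site `±2e_k` has the single neighbour `±e_k`, so `⟨σ_0 σ_{±2e_k}⟩ = tanh β · ⟨σ_0 σ_{±e_k}⟩` (`isingTwoPoint_centre_axis`); a corner has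
exactly two neighbours, so `⟨σ_0 σ_{corner}⟩ = ½ tanh 2β · (⟨σ_0σ_{m₁}⟩ + ⟨σ_0σ_{m₂}⟩)` (`isingTwoPoint_centre_corner`); hence the BOUNDARY SUM
`5·∑_axis + 4·∑_corner = (5 tanh β + 8 tanh 2β) · ∑_m ⟨σ_0σ_m⟩` (`boundarySum_eq`; `5` and `4` = numbers of lattice neighbours of an axis / corner site
OUTSIDE the ball, so `tanh β` times the boundary sum is the Simon–Lieb certificate `φ_β(B₂)` of the ladder engine `IsingSetDecay`).  (ii) GRIFFITHS
MONOTONICITY in `β` (tree `monotoneOn_isingCorr_free` + `gks_two_holds`; `boundarySum_mono`).  (iii) CERTIFICATE → ROW: with the exact core number of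
`IsingBallB2` at `β₀ = artanh(4/21)`, **`b2_boundarySum_le`**: boundary sum `≤ B₀ = 435954834893629439813060512/84847964468924401604428779 = 5.138070…`
on `[0, β₀]`, `(4/21)·B₀ = 0.978680… < 1` (`b2Rate_lt_one`); and the same computation at the SHARPER coupling `β₁ = artanh(23/120) = 0.194067…`
(`e^{2β₁} = 143/97`; kernel sums `coreSumS_one/_obs`): **`b2_boundarySum_le_sharp`**, `(23/120)·B₁ = 0.998581… < 1` (`b2RateS_lt_one`) — the certified
root of `φ(B₂) = 1` being `β_W ≈ 0.1942` (gen 9 numerics), `β₁` exhausts rung 3 to three digits.  Transport into the layer graph: `IsingBallB2Embed/Layer`.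

References: B. Simon, Comm. Math. Phys. 77 (1980) 111; E. Lieb, Comm. Math. Phys. 77 (1980) 127; A. van Enter, R. Fernández, A. Sokal, J. Stat.
Phys. 72 (1993) 879, eq. (4.6); R. Griffiths, J. Math. Phys. 8 (1967) 478, 484.
-/

noncomputable section

open Finset
open Literature.Probability.LatticeModels

namespace Summit.Ventures.YMGap.RobustBall

open B2V

/-! ### Neighbourhoods of the boundary sites -/

/-- The only neighbour of the axis site `±2e_k` in the ball is `±e_k`. [folklore] -/
theorem neighborFinset_axis (k : Fin 3) (s : Bool) : b2Graph.neighborFinset (axis k s) = {mid k s} := by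
  ext q
  rw [SimpleGraph.mem_neighborFinset, b2Graph_adj, mem_singleton]
  cases q <;> simp [B2V.adj, eq_comm]

/-- The two neighbours of the corner `±e_{k+1} ± e_{k+2}` in the ball. [folklore] -/
theorem neighborFinset_corner (k : Fin 3) (s s' : Bool) :
    b2Graph.neighborFinset (corner k s s') = {mid (k + 1) s, mid (k + 2) s'} := by
  ext q
  rw [SimpleGraph.mem_neighborFinset, b2Graph_adj, mem_insert, mem_singleton]
  cases q <;> simp [B2V.adj]

/-- `k + 1 ≠ k + 2` in `Fin 3`. [folklore] -/
theorem fin3_succ_ne (k : Fin 3) : k + 1 ≠ k + 2 := by revert k; decide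

/-- The two neighbours of a corner are distinct. [folklore] -/
theorem mid_succ_ne (k : Fin 3) (s s' : Bool) : mid (k + 1) s ≠ mid (k + 2) s' := by
  intro h
  simp only [mid.injEq] at h
  exact fin3_succ_ne k h.1

/-! ### Heat-bath reduction of the boundary two-point functions -/

/-- `tanh(β u) = u · tanh β` for a spin `u = ±1`. [folklore] -/
theorem tanh_mul_spin (β : ℝ) (u : ℤˣ) : Real.tanh (β * ((u : ℤ) : ℝ)) = ((u : ℤ) : ℝ) * Real.tanh β := by
  rcases Int.units_eq_one_or u with rfl | rfl
  · simp
  · simp [Real.tanh_neg]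

/-- The two-point function is symmetric in its two sites. [folklore] -/
theorem isingTwoPoint_comm' (β : ℝ) (x y : B2V) :
    isingTwoPoint b2Graph univ β 0 .free x y = isingTwoPoint b2Graph univ β 0 .free y x := by
  unfold isingTwoPoint spinPair; congr 1; funext σ; ring

/-- **Axis sites**: `⟨σ_0 σ_{±2e_k}⟩^∅_{B₂;β} = tanh β · ⟨σ_0 σ_{±e_k}⟩^∅_{B₂;β}` (one-site heat-bath identity at the leaf `±2e_k`).
[cite: VanenterFernandezSokal1993, §4.1.2 Step 2, eq. (4.6)] -/
theorem isingTwoPoint_centre_axis (β : ℝ) (k : Fin 3) (s : Bool) :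
    isingTwoPoint b2Graph univ β 0 .free centre (axis k s) = Real.tanh β * isingTwoPoint b2Graph univ β 0 .free centre (mid k s) := by
  rw [isingTwoPoint_comm' β centre (axis k s), isingTwoPoint_comm' β centre (mid k s)]
  unfold isingTwoPoint
  rw [← isingExpect_univ_fixed b2Graph β 0 1, ← isingExpect_univ_fixed b2Graph β 0 1 (spinPair (mid k s) centre)]
  have h := isingExpect_spinAt_mul_eq_tanh b2Graph (mem_univ (axis k s)) β 1 (g := spinAt centre) (measurable_spinAt centre)
    (fun σ u => by simp [spinAt])
  have hfun : (fun σ : SpinConfig B2V => Real.tanh (β * ∑ y ∈ b2Graph.neighborFinset (axis k s), spinAt y σ) * spinAt centre σ) =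
      fun σ => Real.tanh β * spinPair (mid k s) centre σ := by
    funext σ
    rw [neighborFinset_axis, sum_singleton]
    simp only [spinPair, spinAt]
    rw [tanh_mul_spin]
    ring
  rw [show (spinPair (axis k s) centre : SpinConfig B2V → ℝ) = fun σ => spinAt (axis k s) σ * spinAt centre σ from rfl, h, hfun,
    isingExpect_const_mul' b2Graph univ 0 _ β _ (measurable_spinPair (mid k s) centre)]

/-- **Corner sites**: `⟨σ_0 σ_{±e_{k+1} ± e_{k+2}}⟩^∅_{B₂;β} = ½ tanh 2β · (⟨σ_0 σ_{±e_{k+1}}⟩ + ⟨σ_0 σ_{±e_{k+2}}⟩)` (heat bath at a site with exactly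
two neighbours: `tanh β(u+v) = ½ tanh 2β (u+v)`). [cite: VanenterFernandezSokal1993, §4.1.2 Step 2, eq. (4.6)] -/
theorem isingTwoPoint_centre_corner (β : ℝ) (k : Fin 3) (s s' : Bool) :
    isingTwoPoint b2Graph univ β 0 .free centre (corner k s s') =
      Real.tanh (2 * β) / 2 * (isingTwoPoint b2Graph univ β 0 .free centre (mid (k + 1) s) +
        isingTwoPoint b2Graph univ β 0 .free centre (mid (k + 2) s')) := by
  rw [isingTwoPoint_comm' β centre (corner k s s'), isingTwoPoint_comm' β centre (mid (k + 1) s),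
    isingTwoPoint_comm' β centre (mid (k + 2) s')]
  unfold isingTwoPoint
  rw [← isingExpect_univ_fixed b2Graph β 0 1, ← isingExpect_univ_fixed b2Graph β 0 1 (spinPair (mid (k + 1) s) centre),
    ← isingExpect_univ_fixed b2Graph β 0 1 (spinPair (mid (k + 2) s') centre)]
  have h := isingExpect_spinAt_mul_eq_tanh b2Graph (mem_univ (corner k s s')) β 1 (g := spinAt centre) (measurable_spinAt centre)
    (fun σ u => by simp [spinAt])
  have hfun : (fun σ : SpinConfig B2V => Real.tanh (β * ∑ y ∈ b2Graph.neighborFinset (corner k s s'), spinAt y σ) * spinAt centre σ) =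
      fun σ => Real.tanh (2 * β) / 2 * (spinPair (mid (k + 1) s) centre σ + spinPair (mid (k + 2) s') centre σ) := by
    funext σ
    rw [neighborFinset_corner, sum_pair (mid_succ_ne k s s')]
    simp only [spinPair, spinAt]
    rw [tanh_mul_spin_add_spin]
    ring
  rw [show (spinPair (corner k s s') centre : SpinConfig B2V → ℝ) = fun σ => spinAt (corner k s s') σ * spinAt centre σ from rfl, h, hfun,
    isingExpect_const_mul' b2Graph univ 0 _ β _ (f := fun σ => spinPair (mid (k + 1) s) centre σ + spinPair (mid (k + 2) s') centre σ)
      ((measurable_spinPair _ centre).add (measurable_spinPair _ centre)),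
    isingExpect_add' b2Graph univ 0 _ β (measurable_spinPair _ centre) (measurable_spinPair _ centre)]

/-- **THE BOUNDARY SUM IN CLOSED FORM**: `5·∑_{axis} ⟨σ_0σ_x⟩ + 4·∑_{corner} ⟨σ_0σ_x⟩ = (5 tanh β + 8 tanh 2β) · ∑_{m} ⟨σ_0σ_m⟩` (every corner reads two
middles, every middle lies on four corners). [folklore] -/
theorem boundarySum_eq (β : ℝ) :
    5 * ∑ ks : Fin 3 × Bool, isingTwoPoint b2Graph univ β 0 .free centre (axis ks.1 ks.2) +
        4 * ∑ c : Fin 3 × Bool × Bool, isingTwoPoint b2Graph univ β 0 .free centre (corner c.1 c.2.1 c.2.2) =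
      (5 * Real.tanh β + 8 * Real.tanh (2 * β)) * ∑ ks : Fin 3 × Bool, isingTwoPoint b2Graph univ β 0 .free centre (mid ks.1 ks.2) := by
  simp only [isingTwoPoint_centre_axis, isingTwoPoint_centre_corner]
  set ρ : Fin 3 → Bool → ℝ := fun k s => isingTwoPoint b2Graph univ β 0 .free centre (mid k s) with hρ
  simp only [Fintype.sum_prod_type, Fin.sum_univ_three, Fintype.sum_bool, fin3_add]
  ring

/-! ### Griffiths monotonicity in `β` -/

/-- **`β ↦ ⟨σ_0 σ_x⟩^∅_{B₂;β}` is nondecreasing on `[0, ∞)`** (GKS II). [cite: FriedliVelenik2017, Theorem 3.20] -/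
theorem isingTwoPoint_centre_mono {β β' : ℝ} (h0 : 0 ≤ β) (h : β ≤ β') (x : B2V) :
    isingTwoPoint b2Graph univ β 0 .free centre x ≤ isingTwoPoint b2Graph univ β' 0 .free centre x := by
  by_cases hx : centre = x
  · subst hx; simp
  rw [isingTwoPoint_eq_isingCorr _ _ _ _ _ hx, isingTwoPoint_eq_isingCorr _ _ _ _ _ hx]
  exact monotoneOn_isingCorr_free b2Graph (fun _ _ _ _ _ _ => GKSInequalities.gks_two_holds b2Graph) le_rfl (subset_univ _)
    (Set.mem_Ici.2 h0) (Set.mem_Ici.2 (h0.trans h)) h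

/-- **The boundary sum is nondecreasing in `β ≥ 0`.** [cite: FriedliVelenik2017, Theorem 3.20] -/
theorem boundarySum_mono {β β' : ℝ} (h0 : 0 ≤ β) (h : β ≤ β') :
    5 * ∑ ks : Fin 3 × Bool, isingTwoPoint b2Graph univ β 0 .free centre (axis ks.1 ks.2) +
        4 * ∑ c : Fin 3 × Bool × Bool, isingTwoPoint b2Graph univ β 0 .free centre (corner c.1 c.2.1 c.2.2) ≤
      5 * ∑ ks : Fin 3 × Bool, isingTwoPoint b2Graph univ β' 0 .free centre (axis ks.1 ks.2) +
        4 * ∑ c : Fin 3 × Bool × Bool, isingTwoPoint b2Graph univ β' 0 .free centre (corner c.1 c.2.1 c.2.2) := by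
  gcongr with ks _ c _
  · exact isingTwoPoint_centre_mono h0 h _
  · exact isingTwoPoint_centre_mono h0 h _

/-- `tanh 2x = 2 tanh x / (1 + tanh² x)`. [folklore] -/
theorem tanh_two_mul' (x : ℝ) : Real.tanh (2 * x) = 2 * Real.tanh x / (1 + Real.tanh x ^ 2) := by
  have hc : Real.cosh x ≠ 0 := (Real.cosh_pos _).ne'
  have hc2 : Real.cosh x ^ 2 + Real.sinh x ^ 2 ≠ 0 := by positivity
  rw [Real.tanh_eq_sinh_div_cosh, Real.tanh_eq_sinh_div_cosh, Real.sinh_two_mul, Real.cosh_two_mul]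
  field_simp

/-! ### Row at `β₀ = artanh(4/21)` -/

/-- **The rung-3 bound** `B₀ = (5·(4/21) + 8·(168/457)) · ∑_m⟨σ_0σ_m⟩_{β₀} = 435954834893629439813060512 / 84847964468924401604428779 = 5.13807…`.
[folklore] -/
def b2Bound : ℝ := 435954834893629439813060512 / 84847964468924401604428779

/-- **The rung-3 rate** `φ₀ = tanh β₀ · B₀ = (4/21) · B₀ = 0.978680…` (the Simon–Lieb certificate of `B₂` on `[0, β₀]`). [folklore] -/
def b2Rate : ℝ := 4 / 21 * b2Bound

/-- `φ₀ < 1`. [folklore] -/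
theorem b2Rate_lt_one : b2Rate < 1 := by unfold b2Rate b2Bound; norm_num

/-- `0 < φ₀`. [folklore] -/
theorem b2Rate_pos : 0 < b2Rate := by unfold b2Rate b2Bound; norm_num

/-- **THE RUNG-3 SIMON–LIEB BOUND OF `B₂` AT `β₀ = artanh(4/21)`**: for `0 ≤ β ≤ β₀`,
`5 · ∑_{axis x} ⟨σ_0σ_x⟩^∅_{B₂;β} + 4 · ∑_{corner x} ⟨σ_0σ_x⟩^∅_{B₂;β} ≤ B₀ = 5.13807…`. [cite: DuminilCopinTassionCMP2016, Lemma 2.7] -/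
theorem b2_boundarySum_le {β : ℝ} (h0 : 0 ≤ β) (hβ : β ≤ b2Beta) :
    5 * ∑ ks : Fin 3 × Bool, isingTwoPoint b2Graph univ β 0 .free centre (axis ks.1 ks.2) +
        4 * ∑ c : Fin 3 × Bool × Bool, isingTwoPoint b2Graph univ β 0 .free centre (corner c.1 c.2.1 c.2.2) ≤ b2Bound := by
  refine (boundarySum_mono h0 hβ).trans (le_of_eq ?_)
  rw [boundarySum_eq, sum_isingTwoPoint_centre_mid_eq, tanh_two_mul', tanh_b2Beta, b2Bound]
  norm_num

/-! ### The sharper coupling `β₁ = artanh(23/120)` (`e^{2β₁} = 143/97`, `β₁ = 0.194067…`) -/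

/-- **The sharp rung-3 coupling** `β₁ = artanh(23/120) = 0.194067…`. [folklore] -/
def b2BetaS : ℝ := Real.artanh (23 / 120)

/-- `tanh β₁ = 23/120`. [folklore] -/
theorem tanh_b2BetaS : Real.tanh b2BetaS = 23 / 120 := Real.tanh_artanh (by constructor <;> norm_num)

/-- `0 < β₁`. [folklore] -/
theorem b2BetaS_pos : 0 < b2BetaS := Real.artanh_pos (by constructor <;> norm_num)

/-- `β₀ ≤ β₁` (`4/21 ≤ 23/120`). [folklore] -/
theorem b2Beta_le_b2BetaS : b2Beta ≤ b2BetaS := Real.artanh_le_artanh (by norm_num) (by norm_num) (by norm_num)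

/-- The reduced core weight at `tanh β = 23/120`, cleared of denominators: `∏_{k,s}(120 + 23 σ_0 m_{k,s}) · ∏_corners (14400 + 529 m₁m₂)`. [folklore] -/
def coreWS (x : B2Cfg) : ℝ :=
  (∏ ks : Fin 3 × Bool, (120 + 23 * sp x.1 * sp (x.m ks.1 ks.2))) *
    ∏ c : Fin 3 × Bool × Bool, (14400 + 529 * sp (x.m (c.1 + 1) c.2.1) * sp (x.m (c.1 + 2) c.2.2))

/-- **KERNEL ARITHMETIC at `β₁`, denominator.** [folklore] -/
theorem coreSumS_one : ∑ x : B2Cfg, coreWS x = 30950426631548350043657757017944579048232642359230903877632000000 := by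
  simp only [coreWS, Fintype.prod_prod_type, Fin.prod_univ_three, Fintype.prod_bool, B2Cfg.m, fin3_add, if_true,
    if_false, Bool.false_eq_true, Matrix.cons_val_zero, Matrix.cons_val_one, Matrix.cons_val_two, Matrix.head_cons,
    Matrix.tail_cons, Fintype.sum_prod_type, sum_units, sp_one, sp_neg_one]
  norm_num

/-- **KERNEL ARITHMETIC at `β₁`, numerator.** [folklore] -/
theorem coreSumS_obs : ∑ x : B2Cfg, coreObs x * coreWS x = 41174064743238482486029491667274452257679451409167252009779200000 := by
  simp only [coreWS, coreObs, Fintype.prod_prod_type, Fin.prod_univ_three, Fintype.prod_bool, B2Cfg.m, fin3_add, if_true,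
    if_false, Bool.false_eq_true, Matrix.cons_val_zero, Matrix.cons_val_one, Matrix.cons_val_two, Matrix.head_cons,
    Matrix.tail_cons, Fintype.sum_prod_type, Fin.sum_univ_three, Fintype.sum_bool, sum_units, sp_one, sp_neg_one]
  norm_num

/-- The polynomial core weight at `t = 23/120` is `W₁(x) / (120⁶ · 14400¹²)`. [folklore] -/
theorem coreProd_eq_coreWS_div (x : B2Cfg) :
    (∏ ks : Fin 3 × Bool, (1 + (23 / 120 : ℝ) * (sp x.1 * sp (x.m ks.1 ks.2)))) *
        ∏ c : Fin 3 × Bool × Bool, (1 + (23 / 120 : ℝ) ^ 2 * sp (x.m (c.1 + 1) c.2.1) * sp (x.m (c.1 + 2) c.2.2)) =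
      coreWS x / (120 ^ 6 * 14400 ^ 12) := by
  have h1 : ∀ ks : Fin 3 × Bool, (1 + (23 / 120 : ℝ) * (sp x.1 * sp (x.m ks.1 ks.2))) = (120 + 23 * sp x.1 * sp (x.m ks.1 ks.2)) / 120 :=
    fun ks => by ring
  have h2 : ∀ c : Fin 3 × Bool × Bool, (1 + (23 / 120 : ℝ) ^ 2 * sp (x.m (c.1 + 1) c.2.1) * sp (x.m (c.1 + 2) c.2.2)) =
      (14400 + 529 * sp (x.m (c.1 + 1) c.2.1) * sp (x.m (c.1 + 2) c.2.2)) / 14400 := fun c => by ring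
  simp only [h1, h2, prod_div_distrib, prod_const, card_univ, Fintype.card_prod, Fintype.card_fin, Fintype.card_bool, coreWS]
  norm_num
  ring

/-- **Exact core expectations at `β₁`**: `⟨F⟩^∅_{B₂;β₁} = (∑_x F(x) W₁(x)) / ∑_x W₁(x)`. [cite: FriedliVelenik2017, §3.7.3] -/
theorem isingExpect_core_eq_sharp (F : B2Cfg → ℝ) :
    isingExpect b2Graph univ b2BetaS 0 .free (fun σ => F (cfgEquiv σ).1) = (∑ x : B2Cfg, F x * coreWS x) / ∑ x : B2Cfg, coreWS x := by
  rw [PairIsing.isingExpect_univ_free_eq_sum_div, sum_cfg_eq_coreSum b2BetaS F]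
  have hden := sum_cfg_eq_coreSum b2BetaS (fun _ => (1 : ℝ))
  simp only [one_mul] at hden
  rw [hden, tanh_b2BetaS]
  simp only [coreProd_eq_coreWS_div]
  have hK : (0 : ℝ) < Real.cosh b2BetaS ^ 36 * 2 ^ 18 := by positivity
  rw [mul_div_mul_left _ _ hK.ne']
  simp only [mul_div_assoc', ← sum_div]
  rw [div_div_div_cancel_right₀ (by norm_num)]

/-- **THE EXACT CORE NUMBER AT `β₁ = artanh(23/120)`**: `∑_{k,s} ⟨σ_0 σ_{mid k s}⟩^∅_{B₂;β₁} = 1.3303230…` (exact rational). [folklore] -/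
theorem sum_isingTwoPoint_centre_mid_eq_sharp :
    ∑ ks : Fin 3 × Bool, isingTwoPoint b2Graph univ b2BetaS 0 .free centre (mid ks.1 ks.2) =
      41174064743238482486029491667274452257679451409167252009779200000 /
        30950426631548350043657757017944579048232642359230903877632000000 := by
  have hobs : (fun σ : SpinConfig B2V => ∑ ks : Fin 3 × Bool, spinPair centre (mid ks.1 ks.2) σ) =
      fun σ => coreObs (cfgEquiv σ).1 := by
    funext σ
    simp only [coreObs, spinPair, spinAt_eq_sp, cfgEquiv_fst_m, cfgEquiv_fst_fst, mul_sum]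
  have hsum := isingExpect_finset_sum' b2Graph univ 0 BoundaryCondition.free b2BetaS (univ : Finset (Fin 3 × Bool))
    (fun ks σ => spinPair centre (mid ks.1 ks.2) σ) (fun ks => measurable_spinPair centre (mid ks.1 ks.2))
  unfold isingTwoPoint
  rw [hobs, isingExpect_core_eq_sharp coreObs, coreSumS_obs, coreSumS_one] at hsum
  exact hsum.symm

/-- **The sharp rung-3 bound** `B₁ = (5·(23/120) + 8·tanh 2β₁) · ∑_m⟨σ_0σ_m⟩_{β₁} = 5.209990…` (exact rational). [folklore] -/
def b2BoundS : ℝ := 60863253353209658224394368985776038226099 / 11682028924025217676074749534147383497120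

/-- **The sharp rung-3 rate** `φ₁ = (23/120) · B₁ = 0.998581…`. [folklore] -/
def b2RateS : ℝ := 23 / 120 * b2BoundS

/-- `φ₁ < 1`. [folklore] -/
theorem b2RateS_lt_one : b2RateS < 1 := by unfold b2RateS b2BoundS; norm_num

/-- `0 < φ₁`. [folklore] -/
theorem b2RateS_pos : 0 < b2RateS := by unfold b2RateS b2BoundS; norm_num

/-- **THE SHARP RUNG-3 SIMON–LIEB BOUND OF `B₂`**: for `0 ≤ β ≤ β₁ = artanh(23/120)`, the boundary sum is `≤ B₁ = 5.209990…`.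
[cite: DuminilCopinTassionCMP2016, Lemma 2.7] -/
theorem b2_boundarySum_le_sharp {β : ℝ} (h0 : 0 ≤ β) (hβ : β ≤ b2BetaS) :
    5 * ∑ ks : Fin 3 × Bool, isingTwoPoint b2Graph univ β 0 .free centre (axis ks.1 ks.2) +
        4 * ∑ c : Fin 3 × Bool × Bool, isingTwoPoint b2Graph univ β 0 .free centre (corner c.1 c.2.1 c.2.2) ≤ b2BoundS := by
  refine (boundarySum_mono h0 hβ).trans (le_of_eq ?_)
  rw [boundarySum_eq, sum_isingTwoPoint_centre_mid_eq_sharp, tanh_two_mul', tanh_b2BetaS, b2BoundS]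
  norm_num

end Summit.Ventures.YMGap.RobustBall

end
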